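import Literature.Probability.Percolation.SitePaths
import Literature.Probability.Percolation.SiteMonotonicity
import Literature.Probability.Percolation.CerfTwoArms
import HarnessLib

/-!
# Sharpness of the phase transition for site percolation, I: the Duminil-Copin–Tassion functional

Topic `Literature/Probability/Percolation`. Second layer of the discharge of
`Literature.Probability.Percolation.triCriticalProb_eq_half` (Kesten 1982, §3.4: `p_c^site(𝕋) = 1/2`), whose upper
bound `p_c ≤ 1/2` goes through the exponential decay of connection probabilities in the
subcritical phase (Bollobás–Riordan 2006, Ch. 5, Thm. 8, via Menshikov's theorem). We follow the
short proof of sharpness by Duminil-Copin and Tassion in its nearest-neighbour presentation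
(*Enseign. Math.* 62 (2016), Thm. 1.1, item 1, §2.1 "exploration argument"; general version
*Comm. Math. Phys.* 343 (2016), Thm. 1.1), transcribed from bond to **site** percolation on an
arbitrary locally finite graph `G`:

* `siteInterior G S = S \ ∂ⁱⁿS` — the sites of `S` all of whose neighbours lie in `S`;
* `dctEvent G S x z` — for `z ∈ ∂ⁱⁿS`, the event `F_z(S) = {z = x} ∪ {x ⟷ N(z) in I(S)}` that `x`
  is joined to a neighbour of `z` by an open path inside the interior `I(S)` (the site analogue
  of DCT's `{0 ⟷ x in S}, xy ∈ Δ S`);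
* `dctPhi G p S x = ψ_p(S) = Σ_{z ∈ ∂ⁱⁿS} P_p(F_z(S))` — the site analogue of DCT's
  `φ_p(S) = p Σ_{xy ∈ ΔS} P_p(0 ⟷ x in S)` (Enseign. Math. §1; CMP eq. (1.1));
* **`real_exitEvent_le_sum_dctEvent_mul`** — the one-step inequality behind item 1 of DCT's
  Thm. 1.1 (Enseign. Math. §2.1, the displayed bound obtained "using first the union bound, and
  then a decomposition with respect to possible values of `𝒞`"; CMP Lemma 1.5): for finite
  `S ⊆ Λ` and `x ∈ I(S)`,
  `P_p(x ⟷ ∂ⁱⁿΛ in Λ) ≤ Σ_{z ∈ ∂ⁱⁿS} P_p(F_z(S)) · P_p(z ⟷ ∂ⁱⁿΛ in Λ)`,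
  whence `P_p(x ⟷ ∂ⁱⁿΛ in Λ) ≤ ψ_p(S) · max_{z ∈ ∂ⁱⁿS} P_p(z ⟷ ∂ⁱⁿΛ in Λ)`
  (`real_exitEvent_le_dctPhi_mul`).

Proof of the one-step inequality (DCT, Enseign. Math. §2.1, adapted): if `x ⟷ ∂ⁱⁿΛ`, let
`𝒞` be the open cluster of `x` inside `I(S)` and follow an open path from `x` to `∂ⁱⁿΛ`; after its
*last visit* to `𝒞` (`PathIn.last_exit`) it steps to an open site `z ∉ 𝒞` adjacent to `𝒞`, which
must lie in `∂ⁱⁿS` (an open interior neighbour of `𝒞` would belong to `𝒞`), so `F_z(S)` occurs,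
and it continues to `∂ⁱⁿΛ` avoiding `𝒞` together with the closed `I(S)`-neighbours of `𝒞`. Summing
over the value `C` of `𝒞`, the events `{𝒞 = C}` (`clusterEvent`, determined by `C` and its
`I(S)`-neighbours) and `{z ⟷ ∂ⁱⁿΛ off C ∪ N(C)}` are determined by disjoint sets of sites, hence
independent (`sitePercolation_real_inter_of_disjoint`), the events `{𝒞 = C}` are pairwise
disjoint, and their union over the `C` adjacent to `z` is contained in `F_z(S)`.

## References

* H. Duminil-Copin, V. Tassion, A new proof of the sharpness of the phase transition for
  Bernoulli percolation on `ℤ^d`, *Enseign. Math.* 62 (2016) 199–206, Thm. 1.1, §2.1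
  [DuminilCopinTassionEM2016].
* H. Duminil-Copin, V. Tassion, *Comm. Math. Phys.* 343 (2016) 725–745, Thm. 1.1, (1.1),
  Lemma 1.5 [DuminilCopinTassionCMP2016].
* B. Bollobás, O. Riordan, *Percolation*, CUP 2006, Ch. 5, Thm. 8.
* H. Kesten, *Percolation theory for mathematicians*, Birkhäuser 1982, §3.4.

## Mathlib / tree

Mathlib: `measureReal_biUnion_finset_le`, `measureReal_biUnion_finset`, `Finset.sum_mul`.
Tree: `innerBoundary` (`LatticeGraph.lean`), `siteConnIn`, `DeterminedBy`,
`sitePercolation_real_inter_of_disjoint` (`SitePercolationMeasure.lean`), `PathIn`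
(`SitePaths.lean`), `exitEvent` (`SiteMonotonicity.lean`), `siteClusterIn` (`CerfTwoArms.lean`;
our `siteClusterFinset` is its `Finset` form). The bond-configuration `openClusterIn` of
`ConstrainedClusters.lean` is the analogous notion for bond percolation and is not used here. No sharpness / Menshikov /
Aizenman–Barsky theory in Mathlib.
-/

noncomputable section

open MeasureTheory

namespace Literature.Probability.Percolation

variable {V : Type*}

/-! ### Interior, the events `F_z(S)` and the functional `ψ_p(S)` -/

section Interior

variable (G : SimpleGraph V) [DecidableEq V] [G.LocallyFinite]

/-- The interior `I(S) = S \ ∂ⁱⁿS` of a finite set of sites: the sites of `S` all of whose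
neighbours lie in `S`. [folklore] -/
def siteInterior (S : Finset V) : Finset V := S \ LatticeModels.innerBoundary G S

variable {G}

/-- Membership in the interior: `z ∈ S` and every neighbour of `z` lies in `S`. [folklore] -/
theorem mem_siteInterior_iff {S : Finset V} {z : V} :
    z ∈ siteInterior G S ↔ z ∈ S ∧ ∀ y, G.Adj z y → y ∈ S := by
  simp only [siteInterior, Finset.mem_sdiff, LatticeModels.mem_innerBoundary_iff, not_and, not_exists]
  constructor
  · rintro ⟨hz, h⟩
    exact ⟨hz, fun y hy => by_contra fun hyS => h hz y hyS hy⟩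
  · rintro ⟨hz, h⟩
    exact ⟨hz, fun _ y hyS hy => hyS (h y hy)⟩

/-- The interior is contained in the set. [folklore] -/
theorem siteInterior_subset (S : Finset V) : siteInterior G S ⊆ S := Finset.sdiff_subset

/-- A neighbour of an interior site lies in the set. [folklore] -/
theorem mem_of_adj_of_mem_siteInterior {S : Finset V} {z y : V} (hz : z ∈ siteInterior G S)
    (h : G.Adj z y) : y ∈ S :=
  (mem_siteInterior_iff.1 hz).2 y h

/-- A site of `S` outside the interior is an inner boundary site. [folklore] -/
theorem mem_innerBoundary_of_not_mem_siteInterior {S : Finset V} {z : V} (hzS : z ∈ S)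
    (hz : z ∉ siteInterior G S) : z ∈ LatticeModels.innerBoundary G S := by
  by_contra h
  exact hz (Finset.mem_sdiff.2 ⟨hzS, h⟩)

/-- An inner boundary site of `Λ ⊇ S` is not in the interior of `S`. [folklore] -/
theorem not_mem_siteInterior_of_mem_innerBoundary {S Λ : Finset V} (hSΛ : S ⊆ Λ) {b : V}
    (hb : b ∈ LatticeModels.innerBoundary G Λ) : b ∉ siteInterior G S := by
  intro hbI
  obtain ⟨-, y, hyΛ, hby⟩ := LatticeModels.mem_innerBoundary_iff.1 hb
  exact hyΛ (hSΛ (mem_of_adj_of_mem_siteInterior hbI hby))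

variable (G)

/-- **The event `F_z(S)`** (site version of Duminil-Copin–Tassion's `{0 ⟷ x in S}` for a boundary
edge `xy`): either `z = x`, or `x` is joined by an open path inside the interior `I(S)` to some
neighbour of `z`. [cite: DuminilCopinTassionEM2016, §2.1 (proof of Thm. 1.1, item 1)] -/
def dctEvent (S : Finset V) (x z : V) : Set (SiteConfig V) :=
  {ω | z = x ∨ ∃ w, G.Adj z w ∧ ω ∈ siteConnIn G ↑(siteInterior G S) x w}

/-- **The functional `ψ_p(S) = Σ_{z ∈ ∂ⁱⁿS} P_p(F_z(S))`**, site version of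
Duminil-Copin–Tassion's `φ_p(S) = p Σ_{xy ∈ ΔS} P_p(0 ⟷ x in S)` (Enseign. Math. 2016, §1;
Comm. Math. Phys. 2016, (1.1)). [cite: DuminilCopinTassionEM2016, §1 (definition of φ_p(S), Thm. 1.1)] -/
def dctPhi (p : unitInterval) (S : Finset V) (x : V) : ℝ :=
  ∑ z ∈ LatticeModels.innerBoundary G S, (sitePercolation V p).real (dctEvent G S x z)

variable {G}

/-- Membership in `F_z(S)`, unfolded. [folklore] -/
theorem mem_dctEvent_iff {S : Finset V} {x z : V} {ω : SiteConfig V} :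
    ω ∈ dctEvent G S x z ↔ z = x ∨ ∃ w, G.Adj z w ∧ ω ∈ siteConnIn G ↑(siteInterior G S) x w :=
  Iff.rfl

/-- `F_x(S)` is the sure event. [folklore] -/
theorem dctEvent_self (S : Finset V) (x : V) : dctEvent G S x x = Set.univ :=
  Set.eq_univ_of_forall fun _ => Or.inl rfl

/-- `F_z(S)` is determined by the interior `I(S)`. [folklore] -/
theorem determinedBy_dctEvent (S : Finset V) (x z : V) :
    DeterminedBy (dctEvent G S x z) ↑(siteInterior G S) := by
  rw [determinedBy_iff]
  intro ω ω' h
  simp only [mem_dctEvent_iff]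
  refine or_congr_right (exists_congr fun w => and_congr_right fun _ => ?_)
  exact (determinedBy_iff _ _).1 (determinedBy_siteConnIn G _ x w) ω ω' h

/-- `F_z(S)` is measurable. [folklore] -/
theorem measurableSet_dctEvent (S : Finset V) (x z : V) : MeasurableSet (dctEvent G S x z) :=
  (determinedBy_dctEvent S x z).measurableSet_of_finset

/-- `F_z(S)` is increasing. [folklore] -/
theorem isUpperSet_dctEvent (S : Finset V) (x z : V) : IsUpperSet (dctEvent G S x z) := by
  rintro ω ω' hle (h | ⟨w, hzw, hw⟩)
  · exact Or.inl h
  · exact Or.inr ⟨w, hzw, siteConnIn_isUpperSet G _ x w hle hw⟩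

/-- `ψ_p(S) ≥ 0`. [folklore] -/
theorem dctPhi_nonneg (p : unitInterval) (S : Finset V) (x : V) : 0 ≤ dctPhi G p S x :=
  Finset.sum_nonneg fun _ _ => measureReal_nonneg

/-- If `x` is itself an inner boundary site of `S` then `ψ_p(S) ≥ 1` (the term `z = x` is the
sure event). [folklore] -/
theorem one_le_dctPhi_of_mem_innerBoundary (p : unitInterval) {S : Finset V} {x : V}
    (hx : x ∈ LatticeModels.innerBoundary G S) : 1 ≤ dctPhi G p S x := by
  unfold dctPhi
  rw [← Finset.add_sum_erase _ _ hx, dctEvent_self]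
  simp only [probReal_univ, le_add_iff_nonneg_right]
  exact Finset.sum_nonneg fun _ _ => measureReal_nonneg

end Interior

/-! ### The cluster of `x` inside `I` and the events `{𝒞 = C}` -/

section Cluster

variable (G : SimpleGraph V)

open Classical in
/-- The `I`-neighbours of `C` outside `C`: sites `u ∈ I \ C` adjacent to some site of `C`. [folklore] -/
def nbrsIn (I C : Finset V) : Finset V := I.filter fun u => u ∉ C ∧ ∃ c ∈ C, G.Adj c u

/-- **The event `{𝒞 = C}`** that `C` is exactly the open cluster inside `I` (of any of its sites,
`C` being connected): all sites of `C` are open and all `I`-neighbours of `C` are closed. It is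
determined by `C ∪ N_I(C)`. (Duminil-Copin–Tassion, Enseign. Math. 2016, §2.1: "a decomposition
with respect to possible values of `𝒞`".) [cite: DuminilCopinTassionEM2016, §2.1 (proof of Thm. 1.1, item 1)] -/
def clusterEvent (I C : Finset V) : Set (SiteConfig V) :=
  {ω | (∀ c ∈ C, c ∈ ω) ∧ ∀ u ∈ nbrsIn G I C, u ∉ ω}

open Classical in
/-- The open cluster of `x` inside `I` in the configuration `ω`, as a *finite set* of sites:
`{w ∈ I | x ⟷ w in I}`. This is the tree's restricted cluster `Literature.CritPerc.siteClusterIn G ↑I ω x`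
(`CerfTwoArms.lean`, a `Set V`) bundled as a `Finset` (`coe_siteClusterFinset`), which is the form
needed to sum over the possible values `C` of the cluster (`dctFamily`, a `Finset (Finset V)`).
[folklore] -/
def siteClusterFinset (I : Finset V) (x : V) (ω : SiteConfig V) : Finset V :=
  I.filter fun w => w ∈ Literature.Probability.Percolation.siteClusterIn G ↑I ω x

open Classical in
/-- The admissible values of the cluster in the decomposition at the boundary site `z`: connected
subsets `C ⊆ I` containing `x` (every site of `C` is joined to `x` by a `G`-path inside `C`) with a
site adjacent to `z`. [folklore] -/
def dctFamily (I : Finset V) (x z : V) : Finset (Finset V) :=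
  I.powerset.filter fun C => x ∈ C ∧ (∀ c ∈ C, PathIn G ↑C x c) ∧ ∃ c ∈ C, G.Adj c z

variable {G}

/-- Membership in `nbrsIn`, unfolded. [folklore] -/
theorem mem_nbrsIn_iff {I C : Finset V} {u : V} :
    u ∈ nbrsIn G I C ↔ u ∈ I ∧ u ∉ C ∧ ∃ c ∈ C, G.Adj c u := by
  classical
  simp [nbrsIn]

/-- Membership in `siteClusterFinset`, unfolded. [folklore] -/
theorem mem_siteClusterFinset_iff {I : Finset V} {x w : V} {ω : SiteConfig V} :
    w ∈ siteClusterFinset G I x ω ↔ w ∈ I ∧ ω ∈ siteConnIn G ↑I x w := by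
  classical
  simp [siteClusterFinset]

/-- `siteClusterFinset` is the restricted cluster `siteClusterIn` of `CerfTwoArms.lean` (which is
contained in `I`) as a finite set. [folklore] -/
theorem coe_siteClusterFinset (I : Finset V) (x : V) (ω : SiteConfig V) :
    (↑(siteClusterFinset G I x ω) : Set V) = Literature.Probability.Percolation.siteClusterIn G ↑I ω x := by
  ext w
  simp only [Finset.mem_coe, mem_siteClusterFinset_iff, Literature.Probability.Percolation.mem_siteClusterIn_iff,
    and_iff_right_iff_imp]
  rintro ⟨-, -, -, hw, -⟩
  exact hw

/-- Membership in `dctFamily`, unfolded. [folklore] -/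
theorem mem_dctFamily_iff {I : Finset V} {x z : V} {C : Finset V} :
    C ∈ dctFamily G I x z ↔
      C ⊆ I ∧ x ∈ C ∧ (∀ c ∈ C, PathIn G ↑C x c) ∧ ∃ c ∈ C, G.Adj c z := by
  classical
  simp [dctFamily]

/-- `{𝒞 = C}` is determined by `C ∪ N_I(C)`. [folklore] -/
theorem determinedBy_clusterEvent [DecidableEq V] (I C : Finset V) :
    DeterminedBy (clusterEvent G I C) ↑(C ∪ nbrsIn G I C) := by
  rw [determinedBy_iff]
  intro ω ω' h
  have key : ∀ v ∈ C ∪ nbrsIn G I C, v ∈ ω ↔ v ∈ ω' := by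
    intro v hv
    have := Set.ext_iff.1 h v
    simp only [Set.mem_inter_iff] at this
    exact ⟨fun h1 => (this.1 ⟨h1, hv⟩).1, fun h1 => (this.2 ⟨h1, hv⟩).1⟩
  simp only [clusterEvent, Set.mem_setOf_eq]
  refine and_congr (forall₂_congr fun c hc => key c (Finset.mem_union_left _ hc))
    (forall₂_congr fun u hu => not_congr (key u (Finset.mem_union_right _ hu)))

/-- `{𝒞 = C}` is measurable. [folklore] -/
theorem measurableSet_clusterEvent (I C : Finset V) : MeasurableSet (clusterEvent G I C) := by
  classical
  exact (determinedBy_clusterEvent I C).measurableSet_of_finset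

/-- A path inside `A` from `x` only visits sites that are themselves joined to `x` inside `A`.
[folklore] -/
theorem PathIn.restrict {A : Set V} {x c : V} (h : PathIn G A x c) :
    PathIn G {u | u ∈ A ∧ PathIn G A x u} x c := by
  obtain ⟨hx, h⟩ := h
  induction h with
  | refl => exact PathIn.refl ⟨hx, PathIn.refl hx⟩
  | @tail b d hxb hbd ih =>
    have hb : PathIn G A x b := ⟨hx, hxb⟩
    exact ih.tail hbd.1 ⟨hbd.2, hb.tail hbd.1 hbd.2⟩

/-- The open cluster of an open site `x ∈ I` contains `x`. [folklore] -/
theorem mem_siteClusterFinset_self {I : Finset V} {x : V} {ω : SiteConfig V} (hxI : x ∈ I)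
    (hx : x ∈ ω) : x ∈ siteClusterFinset G I x ω :=
  mem_siteClusterFinset_iff.2 ⟨hxI, mem_siteConnIn_self G hx hxI⟩

/-- Sites of the open cluster are open. [folklore] -/
theorem mem_of_mem_siteClusterFinset {I : Finset V} {x w : V} {ω : SiteConfig V}
    (hw : w ∈ siteClusterFinset G I x ω) : w ∈ ω :=
  (mem_siteClusterFinset_iff.1 hw).2.2.1

/-- An open `I`-neighbour of the open cluster belongs to it; equivalently the `I`-neighbours of the
cluster outside it are closed. [folklore] -/
theorem not_mem_of_mem_nbrsIn_siteClusterFinset {I : Finset V} {x u : V} {ω : SiteConfig V}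
    (hu : u ∈ nbrsIn G I (siteClusterFinset G I x ω)) : u ∉ ω := by
  intro huω
  obtain ⟨huI, huC, c, hc, hcu⟩ := mem_nbrsIn_iff.1 hu
  obtain ⟨hcI, hxc⟩ := mem_siteClusterFinset_iff.1 hc
  exact huC (mem_siteClusterFinset_iff.2 ⟨huI, siteConnIn_trans G subset_rfl subset_rfl hxc
    (mem_siteConnIn_of_adj G hxc.2.1 huω hcI huI hcu)⟩)

/-- **The configuration lies in `{𝒞 = C}` for `C` its own open cluster.** [folklore] -/
theorem mem_clusterEvent_siteClusterFinset (I : Finset V) (x : V) (ω : SiteConfig V) :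
    ω ∈ clusterEvent G I (siteClusterFinset G I x ω) :=
  ⟨fun _ hc => mem_of_mem_siteClusterFinset hc, fun _ hu => not_mem_of_mem_nbrsIn_siteClusterFinset hu⟩

/-- The open cluster is connected through itself: every site of it is joined to `x` by a
`G`-path inside the cluster. [folklore] -/
theorem pathIn_siteClusterFinset {I : Finset V} {x c : V} {ω : SiteConfig V}
    (hc : c ∈ siteClusterFinset G I x ω) : PathIn G ↑(siteClusterFinset G I x ω) x c := by
  obtain ⟨-, hxc⟩ := mem_siteClusterFinset_iff.1 hc
  have hp : PathIn G (↑I ∩ ω) x c := PathIn.of_mem_siteConnIn hxc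
  refine hp.restrict.mono ?_
  rintro u ⟨huIω, hxu⟩
  exact Finset.mem_coe.2 (mem_siteClusterFinset_iff.2 ⟨huIω.1, hxu.mem_siteConnIn⟩)

/-- On `{𝒞 = C}` with `C ∋ x` connected, every site of `C` is joined to `x` by an open path inside
`I` (indeed inside `C`). [folklore] -/
theorem mem_siteConnIn_of_mem_clusterEvent {I C : Finset V} (hCI : C ⊆ I) {x c : V}
    (hconn : PathIn G ↑C x c) {ω : SiteConfig V} (hω : ω ∈ clusterEvent G I C) :
    ω ∈ siteConnIn G ↑I x c :=
  (hconn.mono (A' := ↑I ∩ ω) fun u hu =>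
    ⟨Finset.coe_subset.2 hCI hu, hω.1 u (Finset.mem_coe.1 hu)⟩).mem_siteConnIn

/-- **The events `{𝒞 = C}` are pairwise disjoint** over connected `C ∋ x` inside `I`: on
`{𝒞 = C} ∩ {𝒞 = C'}` a path inside `C` from `x ∈ C'` to a site outside `C'` would leave `C'`
through an `I`-neighbour of `C'`, which is closed, yet open as a site of `C`. [folklore] -/
theorem subset_of_mem_clusterEvent_inter {I C C' : Finset V} (hCI : C ⊆ I) {x : V}
    (hconn : ∀ c ∈ C, PathIn G ↑C x c) (hxC' : x ∈ C') {ω : SiteConfig V}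
    (hω : ω ∈ clusterEvent G I C) (hω' : ω ∈ clusterEvent G I C') : C ⊆ C' := by
  intro c hc
  by_contra hcC'
  obtain ⟨a, b, haC', hbC', hbC, hab, -⟩ :=
    (hconn c hc).exit (R := (↑C' : Set V)) (Finset.mem_coe.2 hxC') (mt Finset.mem_coe.1 hcC')
  have hbC : b ∈ C := Finset.mem_coe.1 hbC
  have hb : b ∈ nbrsIn G I C' :=
    mem_nbrsIn_iff.2 ⟨hCI hbC, mt Finset.mem_coe.2 hbC', a, Finset.mem_coe.1 haC', hab⟩
  exact hω'.2 b hb (hω.1 b hbC)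

/-- The events `{𝒞 = C}`, `C ∈ dctFamily G I x z`, are pairwise disjoint. [folklore] -/
theorem pairwiseDisjoint_clusterEvent (I : Finset V) (x z : V) :
    (↑(dctFamily G I x z) : Set (Finset V)).PairwiseDisjoint (clusterEvent G I) := by
  intro C hC C' hC' hne
  rw [Finset.mem_coe, mem_dctFamily_iff] at hC hC'
  rw [Function.onFun, Set.disjoint_left]
  intro ω hω hω'
  exact hne (Finset.Subset.antisymm
    (subset_of_mem_clusterEvent_inter hC.1 hC.2.2.1 hC'.2.1 hω hω')
    (subset_of_mem_clusterEvent_inter hC'.1 hC'.2.2.1 hC.2.1 hω' hω))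

end Cluster

/-! ### The decomposition of `{x ⟷ ∂ⁱⁿΛ}` along the last visit to the cluster -/

section Decomposition

variable {G : SimpleGraph V} [DecidableEq V] [G.LocallyFinite]

/-- On `{𝒞 = C}` with `C ∈ dctFamily G (I(S)) x z`, the event `F_z(S)` occurs (the site of `C`
adjacent to `z` is joined to `x` inside `I(S)`). [folklore] -/
theorem clusterEvent_subset_dctEvent {S : Finset V} {x z : V} {C : Finset V}
    (hC : C ∈ dctFamily G (siteInterior G S) x z) :
    clusterEvent G (siteInterior G S) C ⊆ dctEvent G S x z := by
  intro ω hω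
  obtain ⟨hCI, -, hconn, c, hc, hcz⟩ := mem_dctFamily_iff.1 hC
  exact Or.inr ⟨c, hcz.symm, mem_siteConnIn_of_mem_clusterEvent hCI (hconn c hc) hω⟩

/-- **Duminil-Copin–Tassion decomposition (site version).** For finite `S ⊆ Λ` and `x` in the
interior of `S`: if `x ⟷ ∂ⁱⁿΛ` in `Λ`, then for some `z ∈ ∂ⁱⁿS` and some admissible `C`
(the open cluster of `x` in `I(S)`), the event `{𝒞 = C}` occurs and `z` is joined to `∂ⁱⁿΛ`
by an open path in `Λ` avoiding `C ∪ N_{I(S)}(C)`. (DCT, Enseign. Math. 2016, §2.1: if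
`0 ⟷ ∂Λ_{kL}` "there exists an edge `{x, y} ∈ ΔS` such that the following events occur":
`0 ⟷ x` in `S`, `{x, y}` open, `y` joined to `∂Λ_{kL}` off the cluster `𝒞` of `0` in `S`.) [cite: DuminilCopinTassionEM2016, §2.1 (proof of Thm. 1.1, item 1)] -/
theorem exitEvent_subset_iUnion_clusterEvent {S Λ : Finset V} (hSΛ : S ⊆ Λ) {x : V}
    (hx : x ∈ siteInterior G S) :
    exitEvent G Λ x ⊆ ⋃ z ∈ LatticeModels.innerBoundary G S, ⋃ C ∈ dctFamily G (siteInterior G S) x z,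
      clusterEvent G (siteInterior G S) C ∩
        ⋃ b ∈ LatticeModels.innerBoundary G Λ,
          siteConnIn G ↑(Λ \ (C ∪ nbrsIn G (siteInterior G S) C)) z b := by
  intro ω hω
  set I := siteInterior G S with hI
  obtain ⟨b, hb, hxb⟩ := mem_exitEvent_iff.1 hω
  have hxω : x ∈ ω := hxb.1
  -- the open cluster of `x` inside `I`
  set C := siteClusterFinset G I x ω with hC
  have hxC : x ∈ C := mem_siteClusterFinset_self hx hxω
  have hbC : b ∉ (↑C : Set V) := fun hbC =>
    not_mem_siteInterior_of_mem_innerBoundary hSΛ hb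
      (mem_siteClusterFinset_iff.1 (Finset.mem_coe.1 hbC)).1
  -- last visit of the open path `x → b` to `C`
  have hpath : PathIn G (↑Λ ∩ ω) x b := PathIn.of_mem_siteConnIn hxb
  obtain ⟨a, z, haC, haΛω, hzC, haz, hzb⟩ := hpath.last_exit (Finset.mem_coe.2 hxC) hbC
  have hzω : z ∈ ω := hzb.left_mem.1.2
  have hzΛ : z ∈ Λ := Finset.mem_coe.1 hzb.left_mem.1.1
  have haC' : a ∈ C := Finset.mem_coe.1 haC
  have haI : a ∈ I := (mem_siteClusterFinset_iff.1 haC').1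
  have hzS : z ∈ S := mem_of_adj_of_mem_siteInterior haI haz
  -- `z` is not an interior site: an open interior neighbour of the cluster would belong to it
  have hzI : z ∉ I := fun hzI =>
    hzC (Finset.mem_coe.2 (mem_siteClusterFinset_iff.2 ⟨hzI,
      siteConnIn_trans G subset_rfl subset_rfl (mem_siteClusterFinset_iff.1 haC').2
        (mem_siteConnIn_of_adj G (mem_of_mem_siteClusterFinset haC') hzω haI hzI haz)⟩))
  have hz : z ∈ LatticeModels.innerBoundary G S := mem_innerBoundary_of_not_mem_siteInterior hzS hzI
  -- `C` is admissible at `z`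
  have hCfam : C ∈ dctFamily G I x z :=
    mem_dctFamily_iff.2 ⟨fun w hw => (mem_siteClusterFinset_iff.1 hw).1, hxC,
      fun c hc => pathIn_siteClusterFinset hc, a, haC', haz⟩
  -- the tail path avoids `C ∪ N_I(C)`
  have htail : PathIn G (↑(Λ \ (C ∪ nbrsIn G I C)) ∩ ω) z b := by
    refine hzb.mono ?_
    rintro u ⟨⟨huΛ, huω⟩, huC⟩
    refine ⟨Finset.mem_coe.2 (Finset.mem_sdiff.2 ⟨Finset.mem_coe.1 huΛ, ?_⟩), huω⟩
    rw [Finset.mem_union, not_or]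
    exact ⟨mt Finset.mem_coe.2 huC, fun hu => not_mem_of_mem_nbrsIn_siteClusterFinset hu huω⟩
  simp only [Set.mem_iUnion, Set.mem_inter_iff]
  exact ⟨z, hz, C, hCfam, mem_clusterEvent_siteClusterFinset I x ω, b, hb, htail.mem_siteConnIn⟩

/-! ### The one-step inequality -/

/-- **One-step inequality** (site version of the displayed bound of Duminil-Copin–Tassion,
Enseign. Math. 2016, §2.1, "using first the union bound, and then a decomposition with respect
to possible values of `𝒞`"; Comm. Math. Phys. 2016, Lemma 1.5): for finite `S ⊆ Λ` and `x` in
the interior of `S`,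
`P_p(x ⟷ ∂ⁱⁿΛ in Λ) ≤ Σ_{z ∈ ∂ⁱⁿS} P_p(F_z(S)) · P_p(z ⟷ ∂ⁱⁿΛ in Λ)`.
[cite: DuminilCopinTassionEM2016, §2.1 (proof of Thm. 1.1, item 1)] -/
theorem real_exitEvent_le_sum_dctEvent_mul (p : unitInterval) {S Λ : Finset V} (hSΛ : S ⊆ Λ)
    {x : V} (hx : x ∈ siteInterior G S) :
    (sitePercolation V p).real (exitEvent G Λ x) ≤
      ∑ z ∈ LatticeModels.innerBoundary G S, (sitePercolation V p).real (dctEvent G S x z) *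
        (sitePercolation V p).real (exitEvent G Λ z) := by
  set P := sitePercolation V p with hP
  set I := siteInterior G S with hI
  -- notation for the two factors
  set T : V → Finset V → Set (SiteConfig V) := fun z C =>
    ⋃ b ∈ LatticeModels.innerBoundary G Λ, siteConnIn G ↑(Λ \ (C ∪ nbrsIn G I C)) z b with hT
  have hTexit : ∀ z C, T z C ⊆ exitEvent G Λ z := by
    intro z C ω hω
    simp only [hT, Set.mem_iUnion] at hω
    obtain ⟨b, hb, hω⟩ := hω
    exact mem_exitEvent_iff.2 ⟨b, hb, siteConnIn_mono_set G
      (Finset.coe_subset.2 Finset.sdiff_subset) z b hω⟩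
  have hTdet : ∀ z C, DeterminedBy (T z C) ↑(Λ \ (C ∪ nbrsIn G I C)) := fun z C =>
    DeterminedBy.iUnion fun b => DeterminedBy.iUnion fun _ => determinedBy_siteConnIn G _ z b
  calc P.real (exitEvent G Λ x)
      ≤ P.real (⋃ z ∈ LatticeModels.innerBoundary G S, ⋃ C ∈ dctFamily G I x z, clusterEvent G I C ∩ T z C) :=
        measureReal_mono (exitEvent_subset_iUnion_clusterEvent hSΛ hx) (measure_ne_top _ _)
    _ ≤ ∑ z ∈ LatticeModels.innerBoundary G S, P.real (⋃ C ∈ dctFamily G I x z, clusterEvent G I C ∩ T z C) :=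
        measureReal_biUnion_finset_le _ _
    _ ≤ ∑ z ∈ LatticeModels.innerBoundary G S, ∑ C ∈ dctFamily G I x z, P.real (clusterEvent G I C ∩ T z C) :=
        Finset.sum_le_sum fun z _ => measureReal_biUnion_finset_le _ _
    _ = ∑ z ∈ LatticeModels.innerBoundary G S, ∑ C ∈ dctFamily G I x z,
          P.real (clusterEvent G I C) * P.real (T z C) := by
        refine Finset.sum_congr rfl fun z _ => Finset.sum_congr rfl fun C _ => ?_
        exact sitePercolation_real_inter_of_disjoint p (determinedBy_clusterEvent I C) (hTdet z C)
          Finset.disjoint_sdiff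
    _ ≤ ∑ z ∈ LatticeModels.innerBoundary G S, ∑ C ∈ dctFamily G I x z,
          P.real (clusterEvent G I C) * P.real (exitEvent G Λ z) := by
        refine Finset.sum_le_sum fun z _ => Finset.sum_le_sum fun C _ => ?_
        exact mul_le_mul_of_nonneg_left
          (measureReal_mono (hTexit z C) (measure_ne_top _ _)) measureReal_nonneg
    _ = ∑ z ∈ LatticeModels.innerBoundary G S,
          P.real (⋃ C ∈ dctFamily G I x z, clusterEvent G I C) * P.real (exitEvent G Λ z) := by
        refine Finset.sum_congr rfl fun z _ => ?_
        rw [← Finset.sum_mul, measureReal_biUnion_finset (pairwiseDisjoint_clusterEvent I x z)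
          fun C _ => measurableSet_clusterEvent I C]
    _ ≤ ∑ z ∈ LatticeModels.innerBoundary G S, P.real (dctEvent G S x z) * P.real (exitEvent G Λ z) := by
        refine Finset.sum_le_sum fun z _ => mul_le_mul_of_nonneg_right ?_ measureReal_nonneg
        exact measureReal_mono (Set.iUnion₂_subset fun C hC => clusterEvent_subset_dctEvent hC)
          (measure_ne_top _ _)

/-- **`P_p(x ⟷ ∂ⁱⁿΛ in Λ) ≤ ψ_p(S) · M`** whenever `M` bounds `P_p(z ⟷ ∂ⁱⁿΛ in Λ)` for the inner
boundary sites `z` of `S` (`S ⊆ Λ` finite, `x` interior to `S`); Duminil-Copin–Tassion,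
Enseign. Math. 2016, §2.1: "since `y ∈ Λ_L`, one can bound `P_p(y ⟷ ∂Λ_{kL})` by
`P_p(0 ⟷ ∂Λ_{(k-1)L})`". [cite: DuminilCopinTassionEM2016, §2.1 (proof of Thm. 1.1, item 1)] -/
theorem real_exitEvent_le_dctPhi_mul (p : unitInterval) {S Λ : Finset V} (hSΛ : S ⊆ Λ) {x : V}
    (hx : x ∈ siteInterior G S) {M : ℝ}
    (hM : ∀ z ∈ LatticeModels.innerBoundary G S, (sitePercolation V p).real (exitEvent G Λ z) ≤ M) :
    (sitePercolation V p).real (exitEvent G Λ x) ≤ dctPhi G p S x * M := by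
  refine (real_exitEvent_le_sum_dctEvent_mul p hSΛ hx).trans ?_
  rw [dctPhi, Finset.sum_mul]
  exact Finset.sum_le_sum fun z hz => mul_le_mul_of_nonneg_left (hM z hz) measureReal_nonneg

end Decomposition

end Literature.Probability.Percolation
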